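import Summits.BirchSwinnertonDyer.BirchSwinnertonDyer.Theorems.ByReductionTypeAtTwoMultUpperHalfTowerFiltAddv3
import Summits.BirchSwinnertonDyer.BirchSwinnertonDyer.Theorems.ByReductionTypeAtTwoMultUpperHalfTowerFiltKernel
import HarnessLib

/-!
# Route `ByReductionTypeAtTwo`, crux `MultUpperHalfAtTwo` (item stmt-BirchSwinnertonDyer-19922): the FILTRATION-gap doors with EVERY local binder
# discharged and the SEVENTH per-prime disjunct «ADDITIVE with `ord_ℓ(Δ_min)` ODD ⟹ ONE bit» (seat bsd-2adic-mult-2 GEN 10, part 2 of the doors)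

HONEST FRAMING (cell `bsd-2adic`, run/shared/lean/pub/bsd-2adic/, HUMAN RULINGS D-0036 / D-0054 / D-0074): research route; THEOREMS ONLY;
nothing is booked; BSD is not proved by any of this. PARTITION: X5@2 mult (K4ᵐ, B1·O1) × p = 2 — types-the-object-of; closes none.

§1 `MultTowerFilt.towerGapAtTwo_of_filtration_cert_atTwo_addv3` = GEN 9's `…_cert_atTwo` (p540481) VERBATIM with the seventh disjunct
«`ℓ ∣ c₄ ∧ ℓ^k ∥ Δ_min ∧ 2 ∤ k ∧ 2 ≤ C_ℓ`» (one bit at an additive prime with odd `ord Δ_min`: this seat's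
`MultTowerOddOrd.pTorsion_le_two_of_additive_of_odd_ord`, Kodaira `I_n*` `n` odd / `III` / `III*`). §2 the four habitats at `v ∣ 2` with every
local binder a tree theorem, = GEN 9's `…MultUpperHalfTowerFiltKernel` (p544104) VERBATIM on the new door:
`MultTowerFiltKernel.towerGapAtTwo_of_filtration_cert_{nonsplitTwo, nonsplitTwo_oneBit, splitTwo_oneBit, splitTwo_zeroBit}_addv3`.
Each concludes `O1.TowerGapAtTwo W` from DECIDABLE per-curve data and the two FILTERED counts `hlow`/`hup` of `Sel_{2^∞}(E/ℚ_n)[2]`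
(kit certificates, displayed) with the closed arithmetic `harith` — and NOTHING ELSE.
WHAT IS DISPLAYED, NOT PROVED: the filtered counts (ENGINE A + `S2| SIGMA`, evidence tier). ∀-LEVEL CONTENT: none.

References: R. Greenberg, LNM 1716 (1999) §§1, 3, 4; L. Washington, *Introduction to Cyclotomic Fields*, §13; J. Silverman, GTM 106 VII,
GTM 151 IV–V.
-/

set_option autoImplicit false
-- the Theorems namespace of this sub repeats the summit name by design (D-0017 nested layout: Summit.<S>.<Sub>)
set_option linter.dupNamespace false

noncomputable section

open scoped Classical MatrixGroups ModularForm

open NumberField IsDedekindDomain CongruenceSubgroup WeierstrassCurve Literature.NumberTheory.EllipticCurves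
  Literature.NumberTheory.EllipticCurves.ModularForms
  Literature.NumberTheory.EllipticCurves.Greenberg1999
  Literature.NumberTheory.EllipticCurves.Rank1Residual
  Literature.NumberTheory.EllipticCurves.Rank1Residual.Typed
  Literature.NumberTheory.GaloisRepresentations
  Summit.BirchSwinnertonDyer.Rank1Residual.X5 Summit.BirchSwinnertonDyer.Rank1Residual.X5.O1
  Summit.BirchSwinnertonDyer.Rank1Residual
  Summit.BirchSwinnertonDyer.BirchSwinnertonDyer.Theorems.KatoHalfPinch
  Summit.BirchSwinnertonDyer.BirchSwinnertonDyer.Theorems.MultTowerAddv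
  Rat.HeightOneSpectrum

namespace Summit.BirchSwinnertonDyer.BirchSwinnertonDyer.Theorems.MultTowerFilt

/-! ## §1 The filtration gap certificate, every kernel-side datum decidable, SEVEN disjuncts -/

section Gap

variable (W : WeierstrassCurve ℚ) [W.IsElliptic] [W.IsGloballyMinimal]

/-- **The FILTRATION GAP certificate, every kernel-side datum decidable, the constant at `2` a DATUM, SEVEN disjuncts.** As
`MultTowerAddv.towerGapAtTwo_of_layerSelmer_cert_atTwo_addv2` (proof verbatim) with the two layer counts replaced by the two
filtered counts at ONE layer `n` (window `m + w ≤ 2ⁿ`) and the arithmetic `2^d · C₂ · ∏_{ℓ ∈ P} C_ℓ^{2^{min(n, e_ℓ)}} < 2^{w + a}`.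
[cite: GreenbergLNM1716, §3 Lemmas 3.3–3.5 (PDF pp. 86–90) and pp. 90–93] [cite: SilvermanATAEC1994, IV.9 Table 4.1] -/
theorem towerGapAtTwo_of_filtration_cert_atTwo_addv3
    (h33g : lemma33_localTowerKerPrimary_eq_bot_of_good.{0})
    (hM : lemma33_localTowerKerPrimary_cyclic_of_multiplicative.{0})
    (hA : lemma33_natCard_localTowerKerPrimary_le_four_of_additive.{0})
    (htors : ¬ 2 ∣ W.torsionOrder) {n m w a d : ℕ} (hmw : m + w ≤ 2 ^ n) (C₂ : ℕ)
    (h2 : ∀ κ : ZpExtension ℚ 2, κ.IsCyclotomic → ∀ v : HeightOneSpectrum (𝓞 ℚ),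
      ((2 : ℕ) : 𝓞 ℚ) ∈ v.asIdeal →
        Finite {x : W.localTowerKerPrimary κ (v.adicCompletion ℚ) n // 2 • x = 0} ∧
          Nat.card {x : W.localTowerKerPrimary κ (v.adicCompletion ℚ) n // 2 • x = 0} ≤ C₂)
    (P : Finset ℕ) (hP : ∀ ℓ ∈ P, ℓ.Prime ∧ ℓ ≠ 2)
    (hΔ : ∀ ℓ : ℕ, ℓ.Prime → ℓ ≠ 2 → (ℓ : ℤ) ∣ W.minimalDiscriminantInt → ℓ ∈ P)
    (C e k : ℕ → ℕ) (he : ∀ ℓ ∈ P, ¬ 2 ^ (e ℓ + 4) ∣ ℓ ^ 2 - 1)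
    (hC : ∀ (ℓ : ℕ) [Fact ℓ.Prime], ℓ ∈ P →
      4 ≤ C ℓ ∨ (W.HasMultiplicativeReductionAtPrime ℓ ∧ 2 ≤ C ℓ) ∨
        (W.HasMultiplicativeReductionAtPrime ℓ ∧ (ℓ : ℤ) ^ k ℓ ∣ W.minimalDiscriminantInt ∧
          ¬ (ℓ : ℤ) ^ (k ℓ + 1) ∣ W.minimalDiscriminantInt ∧ ¬ 2 ∣ k ℓ ∧ 1 ≤ C ℓ) ∨
        (¬ (ℓ : ℤ) ∣ W.minimalDiscriminantInt ∧ 1 ≤ C ℓ) ∨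
        ((ℓ : ℤ) ∣ (integralModelInt W).c₄ ∧ (ℓ : ℤ) ^ k ℓ ∣ W.minimalDiscriminantInt ∧
          ¬ (ℓ : ℤ) ^ (k ℓ + 1) ∣ W.minimalDiscriminantInt ∧
          (k ℓ = 2 ∨ k ℓ = 4 ∨ k ℓ = 5 ∨ (7 ≤ k ℓ ∧ k ℓ ≠ 9 ∧ (ℓ : ℤ) ^ k ℓ ∣ (integralModelInt W).c₄ ^ 3)) ∧ 1 ≤ C ℓ) ∨
        ((ℓ : ℤ) ∣ (integralModelInt W).c₄ ∧ (ℓ : ℤ) ^ k ℓ ∣ W.minimalDiscriminantInt ∧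
          ¬ (ℓ : ℤ) ^ (k ℓ + 1) ∣ W.minimalDiscriminantInt ∧ 1 ≤ k ℓ ∧ k ℓ ≠ 6 ∧
          (ℓ : ℤ) ^ k ℓ ∣ (integralModelInt W).c₄ ^ 3 ∧ 2 ≤ C ℓ) ∨
        ((ℓ : ℤ) ∣ (integralModelInt W).c₄ ∧ (ℓ : ℤ) ^ k ℓ ∣ W.minimalDiscriminantInt ∧
          ¬ (ℓ : ℤ) ^ (k ℓ + 1) ∣ W.minimalDiscriminantInt ∧ ¬ 2 ∣ k ℓ ∧ 2 ≤ C ℓ))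
    (hlow : ∀ (κ : ZpExtension ℚ 2) (γ : Field.absoluteGaloisGroup ℚ), κ.IsCyclotomic →
      κ.IsTopGenerator γ →
        2 ^ a ≤ Nat.card {z : W.selmerLayer κ n // 2 • z = 0 ∧
          (⇑(W.conjH1 2 (κ.layerSubgroup n) γ -
            AddMonoidHom.id (W.subgroupH1 2 (κ.layerSubgroup n))))^[m]
            (z : W.subgroupH1 2 (κ.layerSubgroup n)) = 0})
    (hup : ∀ (κ : ZpExtension ℚ 2) (γ : Field.absoluteGaloisGroup ℚ), κ.IsCyclotomic →
      κ.IsTopGenerator γ →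
        Nat.card {z : W.selmerLayer κ n // 2 • z = 0 ∧
          (⇑(W.conjH1 2 (κ.layerSubgroup n) γ -
            AddMonoidHom.id (W.subgroupH1 2 (κ.layerSubgroup n))))^[m + w]
            (z : W.subgroupH1 2 (κ.layerSubgroup n)) = 0} ≤ 2 ^ d)
    (harith : 2 ^ d * C₂ * ∏ ℓ ∈ P, C ℓ ^ 2 ^ min n (e ℓ) < 2 ^ (w + a)) :
    TowerGapAtTwo W := by
  -- `1 ≤ C ℓ` on `P`
  have hC1 : ∀ ℓ ∈ P, 1 ≤ C ℓ := by
    intro ℓ hℓ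
    haveI : Fact ℓ.Prime := ⟨(hP ℓ hℓ).1⟩
    rcases hC ℓ hℓ with h | ⟨-, h⟩ | ⟨-, -, -, -, h⟩ | ⟨-, h⟩ | ⟨-, -, -, -, h⟩ | ⟨-, -, -, -, -, -, h⟩ |
        ⟨-, -, -, -, h⟩ <;> omega
  refine towerGapAtTwo_of_filtration_nat_atTwo_addv3 W h33g hM hA htors hmw C₂ h2 P hP hΔ C
    (fun ℓ _ hℓ ↦ ?_) hlow hup (lt_of_le_of_lt ?_ harith)
  · rcases hC ℓ hℓ with h | h | ⟨hm, h1, h2', hodd, hC'⟩ | h | ⟨hc₄, h1, h2', hcases, hC'⟩ |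
        ⟨hc₄, h1, h2', hk1, hk6, hj, hC'⟩ | ⟨hc₄, h1, h2', hko, hC'⟩
    · exact Or.inl h
    · exact Or.inr (Or.inl h)
    · refine Or.inr (Or.inr (Or.inl ⟨hm, ?_, hC'⟩))
      rwa [padicValInt_eq_of_dvd_of_not_dvd h1 h2']
    · exact Or.inr (Or.inr (Or.inr (Or.inl h)))
    · exact Or.inr (Or.inr (Or.inr (Or.inr (Or.inl ⟨⟨k ℓ, hc₄, h1, h2', hcases⟩, hC'⟩))))
    · exact Or.inr (Or.inr (Or.inr (Or.inr (Or.inr (Or.inl ⟨⟨k ℓ, hc₄, h1, h2', hk1, hk6, hj⟩, hC'⟩)))))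
    · exact Or.inr (Or.inr (Or.inr (Or.inr (Or.inr (Or.inr ⟨⟨k ℓ, hc₄, h1, h2', hko⟩, hC'⟩)))))
  · refine Nat.mul_le_mul_left _ (Finset.prod_le_prod (fun ℓ _ ↦ Nat.zero_le _) fun ℓ hℓ ↦ ?_)
    refine Nat.pow_le_pow_right (hC1 ℓ hℓ) (Nat.pow_le_pow_right (by norm_num) ?_)
    have hℓ2 : ℓ ^ 2 - 1 ≠ 0 := by
      have h3 : 2 ≤ ℓ := (hP ℓ hℓ).1.two_le
      have : 4 ≤ ℓ ^ 2 := by nlinarith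
      omega
    exact min_le_min_left _ (padicValNat_sq_sub_one_sub_three_le hℓ2 (he ℓ hℓ))


end Gap

end Summit.BirchSwinnertonDyer.BirchSwinnertonDyer.Theorems.MultTowerFilt

namespace Summit.BirchSwinnertonDyer.BirchSwinnertonDyer.Theorems.MultTowerFiltKernel

/-! ## §2 The four habitats at the place over `2`, every local binder discharged, SEVEN disjuncts -/

section AtTwo

variable (W : WeierstrassCurve ℚ) [W.IsElliptic] [W.IsGloballyMinimal]

/-- **The FILTRATION GAP certificate, every local binder discharged, at a NON-SPLIT multiplicative `2`, two bits** (`C₂ = 4` from the KERNEL theorem `MultTowerCert.atTwo_le_four_of_nonsplit_kernel` = tower-1's `MultTowerNS2.twoTorsion_localTowerKerPrimary_le_four_nonsplitTwo`, Greenberg p. 93):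
arithmetic `2^d · 4 · ∏_{ℓ ∈ P} C_ℓ^{2^{min(n, e_ℓ)}} < 2^{w + a}`. [cite: GreenbergLNM1716, §3, between Prop. 3.6 and 3.7 (PDF p. 93)]
[cite: SilvermanATAEC1994, IV.9 Table 4.1] -/
theorem towerGapAtTwo_of_filtration_cert_nonsplitTwo_addv3
    (hmult : W.HasMultiplicativeReductionAtPrime 2) (hns : ¬ W.HasSplitMultiplicativeReductionAtPrime 2)
    (htors : ¬ 2 ∣ W.torsionOrder) {n m w a d : ℕ} (hmw : m + w ≤ 2 ^ n)
    (P : Finset ℕ) (hP : ∀ ℓ ∈ P, ℓ.Prime ∧ ℓ ≠ 2)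
    (hΔ : ∀ ℓ : ℕ, ℓ.Prime → ℓ ≠ 2 → (ℓ : ℤ) ∣ W.minimalDiscriminantInt → ℓ ∈ P)
    (C e k : ℕ → ℕ) (he : ∀ ℓ ∈ P, ¬ 2 ^ (e ℓ + 4) ∣ ℓ ^ 2 - 1)
    (hC : ∀ (ℓ : ℕ) [Fact ℓ.Prime], ℓ ∈ P →
      4 ≤ C ℓ ∨ (W.HasMultiplicativeReductionAtPrime ℓ ∧ 2 ≤ C ℓ) ∨
        (W.HasMultiplicativeReductionAtPrime ℓ ∧ (ℓ : ℤ) ^ k ℓ ∣ W.minimalDiscriminantInt ∧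
          ¬ (ℓ : ℤ) ^ (k ℓ + 1) ∣ W.minimalDiscriminantInt ∧ ¬ 2 ∣ k ℓ ∧ 1 ≤ C ℓ) ∨
        (¬ (ℓ : ℤ) ∣ W.minimalDiscriminantInt ∧ 1 ≤ C ℓ) ∨
        ((ℓ : ℤ) ∣ (integralModelInt W).c₄ ∧ (ℓ : ℤ) ^ k ℓ ∣ W.minimalDiscriminantInt ∧
          ¬ (ℓ : ℤ) ^ (k ℓ + 1) ∣ W.minimalDiscriminantInt ∧
          (k ℓ = 2 ∨ k ℓ = 4 ∨ k ℓ = 5 ∨ (7 ≤ k ℓ ∧ k ℓ ≠ 9 ∧ (ℓ : ℤ) ^ k ℓ ∣ (integralModelInt W).c₄ ^ 3)) ∧ 1 ≤ C ℓ) ∨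
        ((ℓ : ℤ) ∣ (integralModelInt W).c₄ ∧ (ℓ : ℤ) ^ k ℓ ∣ W.minimalDiscriminantInt ∧
          ¬ (ℓ : ℤ) ^ (k ℓ + 1) ∣ W.minimalDiscriminantInt ∧ 1 ≤ k ℓ ∧ k ℓ ≠ 6 ∧
          (ℓ : ℤ) ^ k ℓ ∣ (integralModelInt W).c₄ ^ 3 ∧ 2 ≤ C ℓ) ∨
        ((ℓ : ℤ) ∣ (integralModelInt W).c₄ ∧ (ℓ : ℤ) ^ k ℓ ∣ W.minimalDiscriminantInt ∧
          ¬ (ℓ : ℤ) ^ (k ℓ + 1) ∣ W.minimalDiscriminantInt ∧ ¬ 2 ∣ k ℓ ∧ 2 ≤ C ℓ))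
    (hlow : ∀ (κ : ZpExtension ℚ 2) (γ : Field.absoluteGaloisGroup ℚ), κ.IsCyclotomic →
      κ.IsTopGenerator γ →
        2 ^ a ≤ Nat.card {z : W.selmerLayer κ n // 2 • z = 0 ∧
          (⇑(W.conjH1 2 (κ.layerSubgroup n) γ -
            AddMonoidHom.id (W.subgroupH1 2 (κ.layerSubgroup n))))^[m]
            (z : W.subgroupH1 2 (κ.layerSubgroup n)) = 0})
    (hup : ∀ (κ : ZpExtension ℚ 2) (γ : Field.absoluteGaloisGroup ℚ), κ.IsCyclotomic →
      κ.IsTopGenerator γ →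
        Nat.card {z : W.selmerLayer κ n // 2 • z = 0 ∧
          (⇑(W.conjH1 2 (κ.layerSubgroup n) γ -
            AddMonoidHom.id (W.subgroupH1 2 (κ.layerSubgroup n))))^[m + w]
            (z : W.subgroupH1 2 (κ.layerSubgroup n)) = 0} ≤ 2 ^ d)
    (harith : 2 ^ d * 4 * ∏ ℓ ∈ P, C ℓ ^ 2 ^ min n (e ℓ) < 2 ^ (w + a)) : TowerGapAtTwo W :=
  MultTowerFilt.towerGapAtTwo_of_filtration_cert_atTwo_addv3 W lemma33_localTowerKerPrimary_eq_bot_of_good_holds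
    lemma33_localTowerKerPrimary_cyclic_of_multiplicative_holds lemma33_natCard_localTowerKerPrimary_le_four_of_additive_holds htors hmw 4
    (MultTowerCert.atTwo_le_four_of_nonsplit_kernel W hmult hns n) P hP hΔ C e k he hC hlow hup harith

/-- **The FILTRATION GAP certificate, every local binder discharged, at a NON-SPLIT multiplicative `2`, ONE bit** (`C₂ = 2`, KERNEL: Tate unit `u_q ≡ ±3 (mod 8)` from the
decidable datum `Δ_min = 2^k u`, `c₄ = c`, `u c ≡ 3, 5 (mod 8)`; tower-1's `MultTowerNS2.atTwo_le_two_of_nonsplit_oneBit_kernel`, layer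
`n ≥ 1`): arithmetic `2^d · 2 · ∏_{ℓ ∈ P} C_ℓ^{2^{min(n, e_ℓ)}} < 2^{w + a}`. [cite: GreenbergLNM1716, §3, between Prop. 3.6 and 3.7 (PDF p. 93)]
[cite: SilvermanATAEC1994, IV.9 Table 4.1] -/
theorem towerGapAtTwo_of_filtration_cert_nonsplitTwo_oneBit_addv3
    (hmult : W.HasMultiplicativeReductionAtPrime 2) (hns : ¬ W.HasSplitMultiplicativeReductionAtPrime 2)
    (hq : ∃ (k : ℕ) (u c : ℤ), W.minimalDiscriminantInt = 2 ^ k * u ∧ W.c₄ = (c : ℚ) ∧ (u * c % 8 = 3 ∨ u * c % 8 = 5))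
    (htors : ¬ 2 ∣ W.torsionOrder) {n m w a d : ℕ} (hn : 1 ≤ n) (hmw : m + w ≤ 2 ^ n)
    (P : Finset ℕ) (hP : ∀ ℓ ∈ P, ℓ.Prime ∧ ℓ ≠ 2)
    (hΔ : ∀ ℓ : ℕ, ℓ.Prime → ℓ ≠ 2 → (ℓ : ℤ) ∣ W.minimalDiscriminantInt → ℓ ∈ P)
    (C e k : ℕ → ℕ) (he : ∀ ℓ ∈ P, ¬ 2 ^ (e ℓ + 4) ∣ ℓ ^ 2 - 1)
    (hC : ∀ (ℓ : ℕ) [Fact ℓ.Prime], ℓ ∈ P →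
      4 ≤ C ℓ ∨ (W.HasMultiplicativeReductionAtPrime ℓ ∧ 2 ≤ C ℓ) ∨
        (W.HasMultiplicativeReductionAtPrime ℓ ∧ (ℓ : ℤ) ^ k ℓ ∣ W.minimalDiscriminantInt ∧
          ¬ (ℓ : ℤ) ^ (k ℓ + 1) ∣ W.minimalDiscriminantInt ∧ ¬ 2 ∣ k ℓ ∧ 1 ≤ C ℓ) ∨
        (¬ (ℓ : ℤ) ∣ W.minimalDiscriminantInt ∧ 1 ≤ C ℓ) ∨
        ((ℓ : ℤ) ∣ (integralModelInt W).c₄ ∧ (ℓ : ℤ) ^ k ℓ ∣ W.minimalDiscriminantInt ∧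
          ¬ (ℓ : ℤ) ^ (k ℓ + 1) ∣ W.minimalDiscriminantInt ∧
          (k ℓ = 2 ∨ k ℓ = 4 ∨ k ℓ = 5 ∨ (7 ≤ k ℓ ∧ k ℓ ≠ 9 ∧ (ℓ : ℤ) ^ k ℓ ∣ (integralModelInt W).c₄ ^ 3)) ∧ 1 ≤ C ℓ) ∨
        ((ℓ : ℤ) ∣ (integralModelInt W).c₄ ∧ (ℓ : ℤ) ^ k ℓ ∣ W.minimalDiscriminantInt ∧
          ¬ (ℓ : ℤ) ^ (k ℓ + 1) ∣ W.minimalDiscriminantInt ∧ 1 ≤ k ℓ ∧ k ℓ ≠ 6 ∧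
          (ℓ : ℤ) ^ k ℓ ∣ (integralModelInt W).c₄ ^ 3 ∧ 2 ≤ C ℓ) ∨
        ((ℓ : ℤ) ∣ (integralModelInt W).c₄ ∧ (ℓ : ℤ) ^ k ℓ ∣ W.minimalDiscriminantInt ∧
          ¬ (ℓ : ℤ) ^ (k ℓ + 1) ∣ W.minimalDiscriminantInt ∧ ¬ 2 ∣ k ℓ ∧ 2 ≤ C ℓ))
    (hlow : ∀ (κ : ZpExtension ℚ 2) (γ : Field.absoluteGaloisGroup ℚ), κ.IsCyclotomic →
      κ.IsTopGenerator γ →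
        2 ^ a ≤ Nat.card {z : W.selmerLayer κ n // 2 • z = 0 ∧
          (⇑(W.conjH1 2 (κ.layerSubgroup n) γ -
            AddMonoidHom.id (W.subgroupH1 2 (κ.layerSubgroup n))))^[m]
            (z : W.subgroupH1 2 (κ.layerSubgroup n)) = 0})
    (hup : ∀ (κ : ZpExtension ℚ 2) (γ : Field.absoluteGaloisGroup ℚ), κ.IsCyclotomic →
      κ.IsTopGenerator γ →
        Nat.card {z : W.selmerLayer κ n // 2 • z = 0 ∧
          (⇑(W.conjH1 2 (κ.layerSubgroup n) γ -
            AddMonoidHom.id (W.subgroupH1 2 (κ.layerSubgroup n))))^[m + w]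
            (z : W.subgroupH1 2 (κ.layerSubgroup n)) = 0} ≤ 2 ^ d)
    (harith : 2 ^ d * 2 * ∏ ℓ ∈ P, C ℓ ^ 2 ^ min n (e ℓ) < 2 ^ (w + a)) : TowerGapAtTwo W :=
  MultTowerFilt.towerGapAtTwo_of_filtration_cert_atTwo_addv3 W lemma33_localTowerKerPrimary_eq_bot_of_good_holds
    lemma33_localTowerKerPrimary_cyclic_of_multiplicative_holds lemma33_natCard_localTowerKerPrimary_le_four_of_additive_holds htors hmw 2
    (MultTowerNS2.atTwo_le_two_of_nonsplit_oneBit_kernel W hmult hns hq hn) P hP hΔ C e k he hC hlow hup harith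

/-- **The FILTRATION GAP certificate, every local binder discharged, at a SPLIT multiplicative `2`, ONE bit** (`C₂ = 2`, KERNEL: `MultTowerCert.atTwo_le_two_of_split_oneBit_kernel`,
Greenberg pp. 91–92 as tower-1's theorem `hSP1_holds`): arithmetic `2^d · 2 · ∏_{ℓ ∈ P} C_ℓ^{2^{min(n, e_ℓ)}} < 2^{w + a}`.
[cite: GreenbergLNM1716, §3, between Prop. 3.6 and 3.7 (PDF pp. 91–93)] [cite: SilvermanATAEC1994, IV.9 Table 4.1] -/
theorem towerGapAtTwo_of_filtration_cert_splitTwo_oneBit_addv3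
    (hsplit : W.HasSplitMultiplicativeReductionAtPrime 2)
    (htors : ¬ 2 ∣ W.torsionOrder) {n m w a d : ℕ} (hmw : m + w ≤ 2 ^ n)
    (P : Finset ℕ) (hP : ∀ ℓ ∈ P, ℓ.Prime ∧ ℓ ≠ 2)
    (hΔ : ∀ ℓ : ℕ, ℓ.Prime → ℓ ≠ 2 → (ℓ : ℤ) ∣ W.minimalDiscriminantInt → ℓ ∈ P)
    (C e k : ℕ → ℕ) (he : ∀ ℓ ∈ P, ¬ 2 ^ (e ℓ + 4) ∣ ℓ ^ 2 - 1)
    (hC : ∀ (ℓ : ℕ) [Fact ℓ.Prime], ℓ ∈ P →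
      4 ≤ C ℓ ∨ (W.HasMultiplicativeReductionAtPrime ℓ ∧ 2 ≤ C ℓ) ∨
        (W.HasMultiplicativeReductionAtPrime ℓ ∧ (ℓ : ℤ) ^ k ℓ ∣ W.minimalDiscriminantInt ∧
          ¬ (ℓ : ℤ) ^ (k ℓ + 1) ∣ W.minimalDiscriminantInt ∧ ¬ 2 ∣ k ℓ ∧ 1 ≤ C ℓ) ∨
        (¬ (ℓ : ℤ) ∣ W.minimalDiscriminantInt ∧ 1 ≤ C ℓ) ∨
        ((ℓ : ℤ) ∣ (integralModelInt W).c₄ ∧ (ℓ : ℤ) ^ k ℓ ∣ W.minimalDiscriminantInt ∧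
          ¬ (ℓ : ℤ) ^ (k ℓ + 1) ∣ W.minimalDiscriminantInt ∧
          (k ℓ = 2 ∨ k ℓ = 4 ∨ k ℓ = 5 ∨ (7 ≤ k ℓ ∧ k ℓ ≠ 9 ∧ (ℓ : ℤ) ^ k ℓ ∣ (integralModelInt W).c₄ ^ 3)) ∧ 1 ≤ C ℓ) ∨
        ((ℓ : ℤ) ∣ (integralModelInt W).c₄ ∧ (ℓ : ℤ) ^ k ℓ ∣ W.minimalDiscriminantInt ∧
          ¬ (ℓ : ℤ) ^ (k ℓ + 1) ∣ W.minimalDiscriminantInt ∧ 1 ≤ k ℓ ∧ k ℓ ≠ 6 ∧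
          (ℓ : ℤ) ^ k ℓ ∣ (integralModelInt W).c₄ ^ 3 ∧ 2 ≤ C ℓ) ∨
        ((ℓ : ℤ) ∣ (integralModelInt W).c₄ ∧ (ℓ : ℤ) ^ k ℓ ∣ W.minimalDiscriminantInt ∧
          ¬ (ℓ : ℤ) ^ (k ℓ + 1) ∣ W.minimalDiscriminantInt ∧ ¬ 2 ∣ k ℓ ∧ 2 ≤ C ℓ))
    (hlow : ∀ (κ : ZpExtension ℚ 2) (γ : Field.absoluteGaloisGroup ℚ), κ.IsCyclotomic →
      κ.IsTopGenerator γ →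
        2 ^ a ≤ Nat.card {z : W.selmerLayer κ n // 2 • z = 0 ∧
          (⇑(W.conjH1 2 (κ.layerSubgroup n) γ -
            AddMonoidHom.id (W.subgroupH1 2 (κ.layerSubgroup n))))^[m]
            (z : W.subgroupH1 2 (κ.layerSubgroup n)) = 0})
    (hup : ∀ (κ : ZpExtension ℚ 2) (γ : Field.absoluteGaloisGroup ℚ), κ.IsCyclotomic →
      κ.IsTopGenerator γ →
        Nat.card {z : W.selmerLayer κ n // 2 • z = 0 ∧
          (⇑(W.conjH1 2 (κ.layerSubgroup n) γ -
            AddMonoidHom.id (W.subgroupH1 2 (κ.layerSubgroup n))))^[m + w]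
            (z : W.subgroupH1 2 (κ.layerSubgroup n)) = 0} ≤ 2 ^ d)
    (harith : 2 ^ d * 2 * ∏ ℓ ∈ P, C ℓ ^ 2 ^ min n (e ℓ) < 2 ^ (w + a)) : TowerGapAtTwo W :=
  MultTowerFilt.towerGapAtTwo_of_filtration_cert_atTwo_addv3 W lemma33_localTowerKerPrimary_eq_bot_of_good_holds
    lemma33_localTowerKerPrimary_cyclic_of_multiplicative_holds lemma33_natCard_localTowerKerPrimary_le_four_of_additive_holds htors hmw 2
    (MultTowerCert.atTwo_le_two_of_split_oneBit_kernel W hsplit n) P hP hΔ C e k he hC hlow hup harith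

/-- **The FILTRATION GAP certificate, every local binder discharged, at a SPLIT multiplicative `2`, ZERO bits** (`C₂ = 1`, KERNEL: Tate unit `u_q ≡ ±3 (mod 8)` from the
decidable datum, tower-1's `MultTowerCert.atTwo_le_one_of_split_zeroBit_kernel`): arithmetic `2^d · ∏_{ℓ ∈ P} C_ℓ^{2^{min(n, e_ℓ)}} < 2^{w + a}`.
[cite: GreenbergLNM1716, §3, between Prop. 3.6 and 3.7 (PDF p. 93)] [cite: SilvermanATAEC1994, IV.9 Table 4.1] -/
theorem towerGapAtTwo_of_filtration_cert_splitTwo_zeroBit_addv3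
    (hsplit : W.HasSplitMultiplicativeReductionAtPrime 2)
    (htu : ∃ (k : ℕ) (u c : ℤ), W.minimalDiscriminantInt = 2 ^ k * u ∧ W.c₄ = (c : ℚ) ∧ (u * c % 8 = 3 ∨ u * c % 8 = 5))
    (htors : ¬ 2 ∣ W.torsionOrder) {n m w a d : ℕ} (hmw : m + w ≤ 2 ^ n)
    (P : Finset ℕ) (hP : ∀ ℓ ∈ P, ℓ.Prime ∧ ℓ ≠ 2)
    (hΔ : ∀ ℓ : ℕ, ℓ.Prime → ℓ ≠ 2 → (ℓ : ℤ) ∣ W.minimalDiscriminantInt → ℓ ∈ P)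
    (C e k : ℕ → ℕ) (he : ∀ ℓ ∈ P, ¬ 2 ^ (e ℓ + 4) ∣ ℓ ^ 2 - 1)
    (hC : ∀ (ℓ : ℕ) [Fact ℓ.Prime], ℓ ∈ P →
      4 ≤ C ℓ ∨ (W.HasMultiplicativeReductionAtPrime ℓ ∧ 2 ≤ C ℓ) ∨
        (W.HasMultiplicativeReductionAtPrime ℓ ∧ (ℓ : ℤ) ^ k ℓ ∣ W.minimalDiscriminantInt ∧
          ¬ (ℓ : ℤ) ^ (k ℓ + 1) ∣ W.minimalDiscriminantInt ∧ ¬ 2 ∣ k ℓ ∧ 1 ≤ C ℓ) ∨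
        (¬ (ℓ : ℤ) ∣ W.minimalDiscriminantInt ∧ 1 ≤ C ℓ) ∨
        ((ℓ : ℤ) ∣ (integralModelInt W).c₄ ∧ (ℓ : ℤ) ^ k ℓ ∣ W.minimalDiscriminantInt ∧
          ¬ (ℓ : ℤ) ^ (k ℓ + 1) ∣ W.minimalDiscriminantInt ∧
          (k ℓ = 2 ∨ k ℓ = 4 ∨ k ℓ = 5 ∨ (7 ≤ k ℓ ∧ k ℓ ≠ 9 ∧ (ℓ : ℤ) ^ k ℓ ∣ (integralModelInt W).c₄ ^ 3)) ∧ 1 ≤ C ℓ) ∨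
        ((ℓ : ℤ) ∣ (integralModelInt W).c₄ ∧ (ℓ : ℤ) ^ k ℓ ∣ W.minimalDiscriminantInt ∧
          ¬ (ℓ : ℤ) ^ (k ℓ + 1) ∣ W.minimalDiscriminantInt ∧ 1 ≤ k ℓ ∧ k ℓ ≠ 6 ∧
          (ℓ : ℤ) ^ k ℓ ∣ (integralModelInt W).c₄ ^ 3 ∧ 2 ≤ C ℓ) ∨
        ((ℓ : ℤ) ∣ (integralModelInt W).c₄ ∧ (ℓ : ℤ) ^ k ℓ ∣ W.minimalDiscriminantInt ∧
          ¬ (ℓ : ℤ) ^ (k ℓ + 1) ∣ W.minimalDiscriminantInt ∧ ¬ 2 ∣ k ℓ ∧ 2 ≤ C ℓ))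
    (hlow : ∀ (κ : ZpExtension ℚ 2) (γ : Field.absoluteGaloisGroup ℚ), κ.IsCyclotomic →
      κ.IsTopGenerator γ →
        2 ^ a ≤ Nat.card {z : W.selmerLayer κ n // 2 • z = 0 ∧
          (⇑(W.conjH1 2 (κ.layerSubgroup n) γ -
            AddMonoidHom.id (W.subgroupH1 2 (κ.layerSubgroup n))))^[m]
            (z : W.subgroupH1 2 (κ.layerSubgroup n)) = 0})
    (hup : ∀ (κ : ZpExtension ℚ 2) (γ : Field.absoluteGaloisGroup ℚ), κ.IsCyclotomic →
      κ.IsTopGenerator γ →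
        Nat.card {z : W.selmerLayer κ n // 2 • z = 0 ∧
          (⇑(W.conjH1 2 (κ.layerSubgroup n) γ -
            AddMonoidHom.id (W.subgroupH1 2 (κ.layerSubgroup n))))^[m + w]
            (z : W.subgroupH1 2 (κ.layerSubgroup n)) = 0} ≤ 2 ^ d)
    (harith : 2 ^ d * ∏ ℓ ∈ P, C ℓ ^ 2 ^ min n (e ℓ) < 2 ^ (w + a)) : TowerGapAtTwo W :=
  MultTowerFilt.towerGapAtTwo_of_filtration_cert_atTwo_addv3 W lemma33_localTowerKerPrimary_eq_bot_of_good_holds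
    lemma33_localTowerKerPrimary_cyclic_of_multiplicative_holds lemma33_natCard_localTowerKerPrimary_le_four_of_additive_holds htors hmw 1
    (MultTowerCert.atTwo_le_one_of_split_zeroBit_kernel W hsplit htu n) P hP hΔ C e k he hC hlow hup
    (by rw [mul_one]; exact harith)

end AtTwo

end Summit.BirchSwinnertonDyer.BirchSwinnertonDyer.Theorems.MultTowerFiltKernel

end
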